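import Mathlib
import Literature.MathematicalPhysics.QuantumFieldTheory.Balaban1983to89.B6Cor28OneScaleTorus
import Literature.MathematicalPhysics.QuantumFieldTheory.Balaban1983to89.B5Hk163Form166
import Literature.MathematicalPhysics.QuantumFieldTheory.Balaban1983to89.B5RealFields

/-!
# `Balaban1983to89.B6Prop27OneScaleTorus` — T. Bałaban, *Propagators and renormalization transformations for lattice
gauge theories. II*, Commun. Math. Phys. **96** (1984) 223–250 [Balaban1984PropagatorsII]: **Proposition 2.7, the bound
(2.149) — the VERBATIM census typing `B6.Prop27Printed` INHABITED WITH NO HYPOTHESIS on the ONE-SCALE TORUS FAMILY by the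
GENUINE kernel of `(QGQ*)⁻¹ = (Q_kΔ_a⁻¹Q_k*)⁻¹`**, constants uniform in the scale `k` (mesh `η = L^{−k}`), in the torus and in M

statement-level skeleton of published theorems with citation tags; proofs where landed; nothing here is a claim about the Yang–Mills mass gap.
PDF held: `paper:balaban1984-cmp96-propagators-rt-ii` (journal page = PDF page + 222), pp. 246–249 [PDF 24–27] read this session;
[4] = `paper:balaban1984-cmp95-propagators-rt-i` [Balaban1984PropagatorsI], pp. 29, 33–34 [PDF 13, 17–18].

CITATION HEADER (cell `lit-balaban`, Phase-2 proof seat `p01` (gen 5) = unit `lit-balaban-p01`, HOME `run/shared/lean/pub/lit-balaban/`,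
`PHASE2-TARGETS.md` §G, free-target protocol G.5-34(d)); SKELETON row **`B6.Prop2.7`** (kind «model-instance»; the row's verbatim
Prop `B6.Prop27Printed` was so far inhabited by model families with located inputs — `…B6Prop27Kernel`, `…B6Prop27TwoLevel`,
`…B6TowerPrinted` — never by the operator it is about).  Third file of this seat's one-scale series (`…B6Prop23OneScaleTorus`
p253194, `…B6Cor28OneScaleTorus` p254241, whose geometry `oneScaleBondGeo`, `pv`, `Index` are reused).  Imported, not modified:
`…B6` (`B6.Prop27Printed`, `B6.SiteKernel`); the typed torus operators of the cell pub-balaban: `B5Block118.QvOp` (Q_k, (1.18)),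
`B5DeltaA169.DeltaA`/`QvAdj` (Δ_a = Δ − ∂P∂* + aQ*Q (1.69)–(1.71), Q_k*), `B5Hk163Torus.HkOp` (H_k, (1.63)),
`B5Hk163TorusHolder.dker` + `B5Hk163TorusHolderDecay.norm_dker_bpt_le` (the decaying kernel of ∂_νH_k), the β-cell identities
`Beta.FluctuationProjection.QGQ`, `Beta.BlockEffectiveAction.DelK`/`QGQ_inv_eq` ((QGQ*)⁻¹ = a·1 + Δ_k,
Δ_k = η^d·H_kᴴ(½ curl*curl)H_k — (1.65)), `B5Hk163Form166.HkOp_eq_Hk` ((1.63) = (1.103)), `B5RealFields` (reality of the entries).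

WHAT THE PAPER PRINTS.  p. 249 [PDF 27], verbatim = docstring of `B6.Prop27Printed`: *"Proposition 2.7. The operator (QGQ*)⁻¹ is
given by the convergent expansions of the form (2.86), and it satisfies the bound |(QGQ*)⁻¹(b, b′)| ≤ O(1)(L^jη)^{−2}(L^{j′}η)^{−d}
e^{−½δ₄d(b,b′)}, b ∈ Λ_j, b′ ∈ Λ_{j′}. (2.149)"*; p. 248: *"Finally let us consider the operator QGQ* and its inverse. We consider
these operators on the L²-space defined by (2.69) with sites replaced by bonds. The operator QGQ* is positive, hence the inverse is
well defined and positive also."*; p. 246: *"They follow from the Proposition 1.2 and from the formulas and the inequalities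
(1.99)–(1.101) for Q_jG_jQ_j*."*; p. 235: *"If we have one scale, i.e. Λ_k = T₁^{(k)}, then the operator is a unit lattice operator."*
[4] p. 34: *"− ω = (QGQ*)⁻¹B, (1.102) so finally we get the representation H_kB = GQ*(QGQ*)⁻¹B. (1.103)"*; [4] p. 29, (1.65):
*"⟨B, Δ_kB⟩ = ⟨∂H_kB, ∂H_kB⟩"*.

THE READING (one scale, as in `…B6Cor28OneScaleTorus`): `Λ_k = T₁^{(k)}`, 𝔅 = the bonds `b = (y, μ)` of the unit torus `Π_μ ℤ/M_μ`,
`L^jη = 1`, the pairing (2.69) with unit weights, `d(b, b′)` = the periodic ℓ¹ distance of y, y′; `Q = Q_k` on 1-forms, `G = Δ_a⁻¹`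
(a > 0 fixed), so the kernel of Proposition 2.7 is the matrix entry of `(Q_kΔ_a⁻¹Q_k*)⁻¹` (a real matrix, `qgqInvKer_coe`).

WHAT IS PROVED HERE (0 sorry, 0 named facts; axioms standard).  §1 torus-distance helpers.  §2 **`qgqInvKer`** (the `B6.SiteKernel`
= real part of the entries of `(Q_kΔ_a⁻¹Q_k*)⁻¹`) and `qgqInvKer_coe` (the entries ARE real).  §3 the estimate: the curl of the
H_k kernel is entrywise `≤ 2·CdecD·e^{−(κ/(d+1))|block − y|_{T,∞}}` (`norm_curl_HkOp_le`), hence, through (QGQ*)⁻¹ = a·1 + Δ_k and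
the block regrouping of the fine sum, **`abs_qgqInvKer_le`**: `|(QGQ*)⁻¹(b,b′)| ≤ (a + C₂₇(d))·e^{−(κ₁₆₃(d+1)/(2(d+1)))|y − y′|_{T,∞}}`,
`C₂₇(d) = 2·CdecD(d)²(d+1)²·latticeConst(d+1, κ₁₆₃(d+1)/(2(d+1)))`, for EVERY scale k and every torus; §4
**`prop27Printed_oneScaleTorus`**: `B6.Prop27Printed (d+1) (oneScaleBondGeo-family) (qgqInvKer-family)` with witnesses `M₁ = 1`,
`δ₄ = κ₁₆₃(d+1)/(d+1)²`, `O(1) = a + C₂₇(d)` — THE VERBATIM BOUND (2.149) ON THE ONE-SCALE TORUS FAMILY WITH NO ANALYTIC HYPOTHESIS.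
ROUTE ∕ HONEST SCOPE.  (i) ONE scale only (the multi-scale Proposition, levels j ≠ j′, prefactors (L^jη)^{−2}(L^{j′}η)^{−d}, the
metric (2.46) across levels, is the DAG hypothesis of the cell, untouched); scalar model (U = 1) on the torus, the b05/β lineage's
model.  (ii) The expansion clause *"given by the convergent expansions of the form (2.86)"* is not part of the census typing
`B6.Prop27Printed` and is NOT asserted; the route here is [4]'s (1.65)/(1.103) — (QGQ*)⁻¹ = a + Δ_k with Δ_k the H_k-sandwich of
½ curl*curl — and the strip-analyticity decay of ∂H_k of the b05 lineage, i.e. the one-scale content the paper assigns to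
*"(1.99)–(1.101)"*, not the random-walk expansion (2.142)–(2.148).  (iii) Constants explicit but crude (dimension-only apart from
the additive `a`); decay rate κ₁₆₃(d+1)/(2(d+1)) in the sup-distance, halved once more by |x|₁ ≤ (d+1)|x|_∞ bookkeeping into δ₄/2.
-/

namespace Literature.MathematicalPhysics.QuantumFieldTheory.Balaban1983to89.B6Prop27OneScaleTorus

open Finset Matrix
open B4TorusKernel (periodConst)
open B4TorusKernel.MultiPeriod (circAbs torusSupNorm torusSupNorm_nonneg)
open B4Sect5Proof (latticeConst latticeConst_nonneg)
open B4Sect5Torus (circAbs_zero circAbs_neg circAbs_add_le)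
open B5Prop11Plancherel (Tor fine)
open B5Block118 (bpt QvOp)
open B5Blocks16 (bpt_bijective)
open B5DeltaA169 (QvAdj DeltaA calG_eq_DeltaA_inv)
open B5Action121 (CurlOp CurlOp_mulVec Fs_apply)
open B5RealFields (isReal_QvOp isReal_QvAdj isReal_DeltaA_inv)
open B6LowerBound2153Torus (toT rep toT_rep)
open B5Hk163Strip (kappa163 kappa163_pos)
open B5Hk163Torus (HkOp hker)
open B5Hk163TorusHolder (dker)
open B5Hk163TorusHolderDecay (CdecD CdecD_nonneg norm_dker_bpt_le)
open B5Hk163TorusHolderRate (sum_exp_torusSupNorm_sub_rep_le)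
open B5Hk163Form166 (HkOp_eq_Hk)
open Beta.FluctuationProjection (QGQ digitOf bpt_blockOf_digitOf)
open Beta.BlockEffectiveAction (DelK QGQ_inv_eq)
open B6Prop23OneScaleTorus (torusL1)
open B6Cor28OneScaleTorus (pv oneScaleBondGeo oneScaleBondGeo_len Index)

noncomputable section

variable {d : ℕ}

/-! ## §1. Torus-distance helpers -/

section Dist

variable (P : Fin (d + 1) → ℕ) [hP : ∀ μ, NeZero (P μ)]

/-- `1 ≤ P_μ`. [folklore] -/
private theorem one_le_P (i : Fin (d + 1)) : 1 ≤ P i := Nat.one_le_iff_ne_zero.mpr (NeZero.ne (P i))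

omit hP in
/-- `|x|₁ ≤ (d+1)·|x|_∞` on `Π_μ ℤ/P_μ`. [folklore] -/
private theorem torusL1_le_mul_torusSupNorm' (x : Fin (d + 1) → ℤ) : torusL1 P x ≤ (d + 1) * torusSupNorm P x := by
  unfold torusL1 torusSupNorm
  have h : ∀ i ∈ (Finset.univ : Finset (Fin (d + 1))),
      ((circAbs (P i) (x i) : ℤ) : ℝ) ≤ Finset.univ.sup' Finset.univ_nonempty (fun i => ((circAbs (P i) (x i) : ℤ) : ℝ)) :=
    fun i hi => Finset.le_sup' (fun i => ((circAbs (P i) (x i) : ℤ) : ℝ)) hi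
  calc ∑ i, ((circAbs (P i) (x i) : ℤ) : ℝ)
      ≤ ∑ _i : Fin (d + 1), Finset.univ.sup' Finset.univ_nonempty (fun i => ((circAbs (P i) (x i) : ℤ) : ℝ)) :=
        Finset.sum_le_sum h
    _ = (d + 1) * Finset.univ.sup' Finset.univ_nonempty (fun i => ((circAbs (P i) (x i) : ℤ) : ℝ)) := by
        rw [Finset.sum_const, Finset.card_univ, Fintype.card_fin, nsmul_eq_mul]
        push_cast
        ring

/-- `|−x|_∞ = |x|_∞` on the torus. [folklore] -/
private theorem torusSupNorm_neg' (x : Fin (d + 1) → ℤ) : torusSupNorm P (-x) = torusSupNorm P x := by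
  unfold torusSupNorm
  congr 1
  funext i
  rw [Pi.neg_apply, circAbs_neg (one_le_P P i)]

/-- the triangle inequality `|x + z|_∞ ≤ |x|_∞ + |z|_∞` on the torus. [folklore] -/
private theorem torusSupNorm_add_le (x z : Fin (d + 1) → ℤ) :
    torusSupNorm P (x + z) ≤ torusSupNorm P x + torusSupNorm P z := by
  unfold torusSupNorm
  refine Finset.sup'_le _ _ fun i _ => ?_
  have h1 : ((circAbs (P i) ((x + z) i) : ℤ) : ℝ) ≤ ((circAbs (P i) (x i) : ℤ) : ℝ) + ((circAbs (P i) (z i) : ℤ) : ℝ) := by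
    rw [Pi.add_apply]
    exact_mod_cast circAbs_add_le (one_le_P P i) (x i) (z i)
  exact h1.trans (add_le_add (Finset.le_sup' (fun i => ((circAbs (P i) (x i) : ℤ) : ℝ)) (Finset.mem_univ i))
    (Finset.le_sup' (fun i => ((circAbs (P i) (z i) : ℤ) : ℝ)) (Finset.mem_univ i)))

omit hP in
/-- `|0|_∞ = 0`. [folklore] -/
private theorem torusSupNorm_zero' : torusSupNorm P 0 = 0 := by
  unfold torusSupNorm
  simp only [Pi.zero_apply, circAbs_zero, Int.cast_zero]
  exact Finset.sup'_const _ _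

/-- the lattice sum of a product of two decay factors: `Σ_u e^{−κ′|u−y|}e^{−κ′|u−y′|} ≤ Λ(κ′/2)·e^{−(κ′/2)|y−y′|}`. [folklore] -/
private theorem sum_exp_mul_exp_le (y y' : Tor P) {κ' : ℝ} (hκ : 0 < κ') :
    ∑ u : Tor P, Real.exp (-(κ' * torusSupNorm P (rep P u - rep P y))) *
        Real.exp (-(κ' * torusSupNorm P (rep P u - rep P y')))
      ≤ latticeConst (d + 1) (κ' / 2) * Real.exp (-(κ' / 2 * torusSupNorm P (rep P y - rep P y'))) := by
  have hterm : ∀ u : Tor P,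
      Real.exp (-(κ' * torusSupNorm P (rep P u - rep P y))) * Real.exp (-(κ' * torusSupNorm P (rep P u - rep P y')))
        ≤ Real.exp (-(κ' / 2 * torusSupNorm P (rep P y - rep P y'))) *
          Real.exp (-(κ' / 2 * torusSupNorm P (rep P y - rep P u))) := by
    intro u
    have hB : 0 ≤ torusSupNorm P (rep P u - rep P y') := torusSupNorm_nonneg (one_le_P P) _
    have hsym : torusSupNorm P (rep P y - rep P u) = torusSupNorm P (rep P u - rep P y) := by
      rw [← torusSupNorm_neg' P (rep P y - rep P u), neg_sub]
    have htri : torusSupNorm P (rep P y - rep P y')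
        ≤ torusSupNorm P (rep P u - rep P y) + torusSupNorm P (rep P u - rep P y') := by
      have h := torusSupNorm_add_le P (rep P y - rep P u) (rep P u - rep P y')
      rw [sub_add_sub_cancel, hsym] at h
      exact h
    rw [← Real.exp_add, ← Real.exp_add, hsym]
    apply Real.exp_le_exp.mpr
    have h1 := mul_le_mul_of_nonneg_left htri (half_pos hκ).le
    have h2 : 0 ≤ κ' * torusSupNorm P (rep P u - rep P y') := mul_nonneg hκ.le hB
    linarith
  calc ∑ u : Tor P, Real.exp (-(κ' * torusSupNorm P (rep P u - rep P y))) *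
        Real.exp (-(κ' * torusSupNorm P (rep P u - rep P y')))
      ≤ ∑ u : Tor P, Real.exp (-(κ' / 2 * torusSupNorm P (rep P y - rep P y'))) *
          Real.exp (-(κ' / 2 * torusSupNorm P (rep P y - rep P u))) := Finset.sum_le_sum fun u _ => hterm u
    _ = Real.exp (-(κ' / 2 * torusSupNorm P (rep P y - rep P y'))) *
          ∑ u : Tor P, Real.exp (-(κ' / 2 * torusSupNorm P (rep P y - rep P u))) := by rw [Finset.mul_sum]
    _ ≤ Real.exp (-(κ' / 2 * torusSupNorm P (rep P y - rep P y'))) * latticeConst (d + 1) (κ' / 2) :=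
        mul_le_mul_of_nonneg_left (sum_exp_torusSupNorm_sub_rep_le P (half_pos hκ) (rep P y)) (Real.exp_pos _).le
    _ = _ := mul_comm _ _

end Dist

/-! ## §2. The kernel of `(QGQ*)⁻¹` on the one-scale torus family -/

section Kernel

variable (d) (L : ℕ) [NeZero L]

/-- `1 ≤ L^k`. [folklore] -/
private theorem one_le_pow' (k : ℕ) : 1 ≤ L ^ k := Nat.one_le_pow k L (Nat.pos_of_ne_zero (NeZero.ne L))

/-- **The kernel of `(QGQ*)⁻¹` on the one-scale torus, bond version** (pairing (2.69) with unit weights): the entries of the inverse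
matrix of `Q_kΔ_a⁻¹Q_k*` — `Q = Q_k` the block averaging (1.18) of 1-forms (`B5Block118.QvOp (L^k)`), `G = Δ_a⁻¹`
(`B5DeltaA169.DeltaA`), `Q* = Q_k*` (`B5DeltaA169.QvAdj`) — read as real numbers (they are real, `qgqInvKer_coe`).
[cite: Balaban1984PropagatorsII, Prop. 2.7 (2.149) p.249; p.248 («The operator QGQ* is positive, hence the inverse is well defined»)] -/
def qgqInvKer (k : ℕ) (M : Fin (d + 1) → ℕ+) (Mb R : ℕ) (a : ℝ) : B6.SiteKernel (oneScaleBondGeo d L k M Mb R) :=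
  ⟨fun b b' => ((QvOp (L ^ k) (pv M) * (DeltaA (L ^ k) (pv M) a)⁻¹ * QvAdj (L ^ k) (pv M))⁻¹ b b').re⟩

/-- **the entries of `(Q_kΔ_a⁻¹Q_k*)⁻¹` are real**: the kernel `qgqInvKer` IS the matrix entry. [cite: Balaban1984PropagatorsII, p.248 (QGQ* positive, its inverse well defined; typed reading)] -/
theorem qgqInvKer_coe (k : ℕ) (M : Fin (d + 1) → ℕ+) (Mb R : ℕ) (a : ℝ) (b b' : (oneScaleBondGeo d L k M Mb R).Site) :
    (((qgqInvKer d L k M Mb R a).ker b b' : ℝ) : ℂ) =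
      (QvOp (L ^ k) (pv M) * (DeltaA (L ^ k) (pv M) a)⁻¹ * QvAdj (L ^ k) (pv M))⁻¹ b b' := by
  have h := (((isReal_QvOp (L ^ k) (pv M)).mul (isReal_DeltaA_inv (L ^ k) (pv M) a)).mul
    (isReal_QvAdj (L ^ k) (pv M))).inv
  exact Complex.ext (Complex.ofReal_re _) (by rw [Complex.ofReal_im, h.im_eq_zero b b'])

variable {d L}

/-- `Q_kΔ_a⁻¹Q_k*` is the β cell's `QGQ` ((1.71) `Δ_a⁻¹ = 𝒢`). [folklore] -/
private theorem qgq_eq (k : ℕ) (M : Fin (d + 1) → ℕ+) {a : ℝ} (ha : 0 < a) :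
    QvOp (L ^ k) (pv M) * (DeltaA (L ^ k) (pv M) a)⁻¹ * QvAdj (L ^ k) (pv M) = QGQ (L ^ k) (one_le_pow' L k) (pv M) a ha := by
  rw [QGQ, calG_eq_DeltaA_inv]

end Kernel

/-! ## §3. The estimate: `|(QGQ*)⁻¹(b,b′)| ≤ (a + C₂₇) e^{−(κ/2)|y − y′|_{T,∞}}` uniformly in the scale -/

section Estimate

/-- **the curl of the `H_k` kernel decays**: `|(curl H_k)((x,(μ,ν)),(y,λ))| = |∂_μH_{νλ} − ∂_νH_{μλ}| ≤ 2·CdecD·e^{−(κ/(d+1))|y(x) − y|_{T,∞}}`,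
y(x) the block of x, uniformly in n and in the torus. [folklore] -/
private theorem norm_curl_HkOp_le (n : ℕ) [NeZero n] (M : Fin (d + 1) → ℕ) [∀ μ, NeZero (M μ)]
    (x : Tor (fine n M)) (μ ν : Fin (d + 1)) (y : Tor M) (lam : Fin (d + 1)) :
    ‖(CurlOp (fine n M) (n : ℂ) * HkOp n M) (x, (μ, ν)) (y, lam)‖ ≤
      2 * CdecD d * Real.exp (-(kappa163 (d + 1) / (d + 1) * torusSupNorm M (rep M (B5Blocks16.blockOf n M x) - rep M y))) := by
  have h : (CurlOp (fine n M) (n : ℂ) * HkOp n M) (x, (μ, ν)) (y, lam) = dker n M ν lam μ x y - dker n M μ lam ν x y := by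
    have h1 : (CurlOp (fine n M) (n : ℂ) * HkOp n M) (x, (μ, ν)) (y, lam)
        = (CurlOp (fine n M) (n : ℂ) *ᵥ fun i => HkOp n M i (y, lam)) (x, (μ, ν)) := by
      simp only [Matrix.mul_apply, Matrix.mulVec, dotProduct]
    rw [h1, CurlOp_mulVec, Fs_apply]
    simp only [HkOp, dker]
    ring
  rw [h]
  have e : bpt n M (toT M (rep M (B5Blocks16.blockOf n M x))) (digitOf n M x) = x := by rw [toT_rep, bpt_blockOf_digitOf]
  have h2 := norm_dker_bpt_le n M ν lam μ (digitOf n M x) (rep M (B5Blocks16.blockOf n M x)) (rep M y)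
  have h3 := norm_dker_bpt_le n M μ lam ν (digitOf n M x) (rep M (B5Blocks16.blockOf n M x)) (rep M y)
  rw [e, toT_rep] at h2 h3
  calc ‖dker n M ν lam μ x y - dker n M μ lam ν x y‖ ≤ ‖dker n M ν lam μ x y‖ + ‖dker n M μ lam ν x y‖ := norm_sub_le _ _
    _ ≤ _ := by unfold CdecD; linarith

/-- block regrouping of a fine sum: `Σ_{x ∈ T_η} f(y(x)) = n^{d+1} Σ_{y ∈ T₁} f(y)`. [folklore] -/
private theorem sum_fine_blockOf (n : ℕ) [NeZero n] (M : Fin (d + 1) → ℕ) [∀ μ, NeZero (M μ)] (f : Tor M → ℝ) :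
    ∑ x : Tor (fine n M), f (B5Blocks16.blockOf n M x) = (n : ℝ) ^ (d + 1) * ∑ u : Tor M, f u := by
  have h := Fintype.sum_equiv (Equiv.ofBijective _ (bpt_bijective n M))
    (fun yj : Tor M × (Fin (d + 1) → Fin n) => f yj.1) (fun x => f (B5Blocks16.blockOf n M x))
    (fun yj => by simp only [Equiv.ofBijective_apply, B5Blocks16.blockOf_bpt])
  rw [← h, Fintype.sum_prod_type]
  simp only [Finset.sum_const, Finset.card_univ, Fintype.card_fun, Fintype.card_fin, nsmul_eq_mul]
  rw [← Finset.mul_sum, Nat.cast_pow]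

/-- the constant of the estimate: `C₂₇(d) = 2·CdecD(d)²·(d+1)²·Λ(d+1, κ₁₆₃(d+1)/(2(d+1)))` (dimension only).
[cite: Balaban1984PropagatorsII, Prop. 2.7 (2.149) p.249 (the O(1); value ours)] -/
def C27 (d : ℕ) : ℝ :=
  2 * CdecD d ^ 2 * ((d : ℝ) + 1) ^ 2 * latticeConst (d + 1) (kappa163 (d + 1) / (d + 1) / 2)

/-- `0 ≤ C₂₇`. [folklore] -/
private theorem C27_nonneg (d : ℕ) : 0 ≤ C27 d := by
  unfold C27
  have h1 := CdecD_nonneg (d := d)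
  have h2 : 0 ≤ latticeConst (d + 1) (kappa163 (d + 1) / (d + 1) / 2) :=
    latticeConst_nonneg _ (by have := kappa163_pos (d + 1); positivity)
  positivity

/-- the weighted double sum of curl entries: `Σ_r |(curl H_k)(r,b)||(curl H_k)(r,b′)| ≤ n^{d+1}·2C₂₇·e^{−(κ/2)|y−y′|}`. [folklore] -/
private theorem sum_norm_curl_mul_le (n : ℕ) [NeZero n] (M : Fin (d + 1) → ℕ) [∀ μ, NeZero (M μ)]
    (b b' : Tor M × Fin (d + 1)) :
    ∑ r, ‖(CurlOp (fine n M) (n : ℂ) * HkOp n M) r b‖ * ‖(CurlOp (fine n M) (n : ℂ) * HkOp n M) r b'‖ ≤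
      (n : ℝ) ^ (d + 1) * (2 * C27 d *
        Real.exp (-(kappa163 (d + 1) / (d + 1) / 2 * torusSupNorm M (rep M b.1 - rep M b'.1)))) := by
  obtain ⟨y, lam⟩ := b
  obtain ⟨y', lam'⟩ := b'
  set W := CurlOp (fine n M) (n : ℂ) * HkOp n M
  have hκ : 0 < kappa163 (d + 1) / (d + 1) := div_pos (kappa163_pos _) (by positivity)
  have hS : 0 ≤ CdecD d := CdecD_nonneg
  let E : Tor M → Tor M → ℝ := fun u v => Real.exp (-(kappa163 (d + 1) / (d + 1) * torusSupNorm M (rep M u - rep M v)))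
  have hterm : ∀ (x : Tor (fine n M)) (p : Fin (d + 1) × Fin (d + 1)),
      ‖W (x, p) (y, lam)‖ * ‖W (x, p) (y', lam')‖ ≤ (2 * CdecD d * E (B5Blocks16.blockOf n M x) y) * (2 * CdecD d * E (B5Blocks16.blockOf n M x) y') := by
    intro x p
    obtain ⟨μ, ν⟩ := p
    exact mul_le_mul (norm_curl_HkOp_le n M x μ ν y lam) (norm_curl_HkOp_le n M x μ ν y' lam') (norm_nonneg _)
      (mul_nonneg (mul_nonneg zero_le_two hS) (Real.exp_pos _).le)
  calc ∑ r, ‖W r (y, lam)‖ * ‖W r (y', lam')‖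
      = ∑ x : Tor (fine n M), ∑ p : Fin (d + 1) × Fin (d + 1), ‖W (x, p) (y, lam)‖ * ‖W (x, p) (y', lam')‖ :=
        Fintype.sum_prod_type _
    _ ≤ ∑ x : Tor (fine n M), ∑ _p : Fin (d + 1) × Fin (d + 1),
          (2 * CdecD d * E (B5Blocks16.blockOf n M x) y) * (2 * CdecD d * E (B5Blocks16.blockOf n M x) y') :=
        Finset.sum_le_sum fun x _ => Finset.sum_le_sum fun p _ => hterm x p
    _ = ∑ x : Tor (fine n M), ((d : ℝ) + 1) ^ 2 * (4 * CdecD d ^ 2 * (E (B5Blocks16.blockOf n M x) y * E (B5Blocks16.blockOf n M x) y')) := by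
        refine Finset.sum_congr rfl fun x _ => ?_
        rw [Finset.sum_const, Finset.card_univ, Fintype.card_prod, Fintype.card_fin, nsmul_eq_mul]
        push_cast
        ring
    _ = (n : ℝ) ^ (d + 1) * ∑ u : Tor M, ((d : ℝ) + 1) ^ 2 * (4 * CdecD d ^ 2 * (E u y * E u y')) :=
        sum_fine_blockOf n M (fun u => ((d : ℝ) + 1) ^ 2 * (4 * CdecD d ^ 2 * (E u y * E u y')))
    _ = (n : ℝ) ^ (d + 1) * (((d : ℝ) + 1) ^ 2 * (4 * CdecD d ^ 2 * ∑ u : Tor M, E u y * E u y')) := by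
        congr 1
        rw [Finset.mul_sum, Finset.mul_sum]
    _ ≤ (n : ℝ) ^ (d + 1) * (((d : ℝ) + 1) ^ 2 * (4 * CdecD d ^ 2 * (latticeConst (d + 1) (kappa163 (d + 1) / (d + 1) / 2) *
          Real.exp (-(kappa163 (d + 1) / (d + 1) / 2 * torusSupNorm M (rep M y - rep M y')))))) :=
        mul_le_mul_of_nonneg_left (mul_le_mul_of_nonneg_left
          (mul_le_mul_of_nonneg_left (sum_exp_mul_exp_le M y y' hκ) (by positivity)) (by positivity)) (by positivity)
    _ = _ := by
        unfold C27
        ring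

/-- **the Δ_k entries decay**: `|Δ_k(b, b′)| ≤ C₂₇·e^{−(κ/2)|y − y′|_{T,∞}}` for the β cell's `DelK = η^{d+1}H_kᴴ(½curl*curl)H_k`,
uniformly in n and in the torus. [folklore] -/
private theorem norm_DelK_apply_le (n : ℕ) [NeZero n] (hn : 1 ≤ n) (M : Fin (d + 1) → ℕ) [∀ μ, NeZero (M μ)] (a : ℝ)
    (ha : 0 < a) (b b' : Tor M × Fin (d + 1)) :
    ‖DelK n hn M a ha b b'‖ ≤ C27 d * Real.exp (-(kappa163 (d + 1) / (d + 1) / 2 * torusSupNorm M (rep M b.1 - rep M b'.1))) := by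
  have hnR : (0 : ℝ) < (n : ℝ) ^ (d + 1) := by
    have : (0 : ℝ) < n := by exact_mod_cast Nat.pos_of_ne_zero (NeZero.ne n)
    positivity
  have hD : DelK n hn M a ha = ((n : ℂ) ^ (d + 1))⁻¹ • ((1 / 2 : ℂ) •
      ((CurlOp (fine n M) (n : ℂ) * HkOp n M)ᴴ * (CurlOp (fine n M) (n : ℂ) * HkOp n M))) := by
    rw [DelK, ← HkOp_eq_Hk n hn M a ha]
    simp only [Matrix.mul_smul, Matrix.smul_mul, Matrix.conjTranspose_mul, Matrix.mul_assoc]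
  rw [hD, Matrix.smul_apply, Matrix.smul_apply, Matrix.mul_apply, smul_eq_mul, smul_eq_mul, norm_mul, norm_mul]
  simp_rw [Matrix.conjTranspose_apply]
  have hk : ‖((n : ℂ) ^ (d + 1))⁻¹‖ = ((n : ℝ) ^ (d + 1))⁻¹ := by rw [norm_inv, norm_pow, Complex.norm_natCast]
  have hs : ‖(1 / 2 : ℂ)‖ = 1 / 2 := by rw [norm_div, norm_one, Complex.norm_two]
  rw [hk, hs]
  have hsum : ‖∑ r, star ((CurlOp (fine n M) (n : ℂ) * HkOp n M) r b) * (CurlOp (fine n M) (n : ℂ) * HkOp n M) r b'‖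
      ≤ ∑ r, ‖(CurlOp (fine n M) (n : ℂ) * HkOp n M) r b‖ * ‖(CurlOp (fine n M) (n : ℂ) * HkOp n M) r b'‖ := by
    refine (norm_sum_le _ _).trans (Finset.sum_le_sum fun r _ => ?_)
    rw [norm_mul, norm_star]
  calc ((n : ℝ) ^ (d + 1))⁻¹ * (1 / 2 * ‖∑ r, star ((CurlOp (fine n M) (n : ℂ) * HkOp n M) r b) *
        (CurlOp (fine n M) (n : ℂ) * HkOp n M) r b'‖)
      ≤ ((n : ℝ) ^ (d + 1))⁻¹ * (1 / 2 * ((n : ℝ) ^ (d + 1) * (2 * C27 d *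
          Real.exp (-(kappa163 (d + 1) / (d + 1) / 2 * torusSupNorm M (rep M b.1 - rep M b'.1)))))) :=
        mul_le_mul_of_nonneg_left (mul_le_mul_of_nonneg_left (hsum.trans (sum_norm_curl_mul_le n M b b'))
          (by norm_num)) (inv_nonneg.mpr hnR.le)
    _ = _ := by
        have hn0 : (n : ℝ) ^ (d + 1) ≠ 0 := hnR.ne'
        field_simp

variable (d) (L : ℕ) [NeZero L]

/-- **THE ESTIMATE (2.149) ON ONE SCALE, GENUINE OPERATOR**: for every scale k, every torus, every a > 0 and all bonds b = (y, μ),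
b′ = (y′, μ′) of the unit torus, `|(Q_kΔ_a⁻¹Q_k*)⁻¹(b, b′)| ≤ (a + C₂₇(d))·e^{−(κ₁₆₃(d+1)/(2(d+1)))·|y − y′|_{T,∞}}` — from
(QGQ*)⁻¹ = a·1 + Δ_k and `norm_DelK_apply_le`. [cite: Balaban1984PropagatorsII, Prop. 2.7 (2.149) p.249 (one scale; constants and route ours, via [Balaban1984PropagatorsI] (1.65), (1.103))] -/
theorem abs_qgqInvKer_le (k : ℕ) (M : Fin (d + 1) → ℕ+) (Mb R : ℕ) {a : ℝ} (ha : 0 < a)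
    (b b' : (oneScaleBondGeo d L k M Mb R).Site) :
    |(qgqInvKer d L k M Mb R a).ker b b'| ≤ (a + C27 d) *
      Real.exp (-(kappa163 (d + 1) / (d + 1) / 2 * torusSupNorm (pv M) (rep (pv M) b.1 - rep (pv M) b'.1))) := by
  have hepos : 0 < Real.exp (-(kappa163 (d + 1) / (d + 1) / 2 *
      torusSupNorm (pv M) (rep (pv M) b.1 - rep (pv M) b'.1))) := Real.exp_pos _
  have hC := C27_nonneg d
  have hDel := norm_DelK_apply_le (L ^ k) (one_le_pow' L k) (pv M) a ha b b'
  show |((QvOp (L ^ k) (pv M) * (DeltaA (L ^ k) (pv M) a)⁻¹ * QvAdj (L ^ k) (pv M))⁻¹ b b').re| ≤ _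
  rw [qgq_eq k M ha, QGQ_inv_eq, Matrix.add_apply, Matrix.smul_apply, smul_eq_mul]
  refine (Complex.abs_re_le_norm _).trans ((norm_add_le _ _).trans ?_)
  rw [norm_mul, Complex.norm_real, Real.norm_eq_abs, abs_of_pos ha, Matrix.one_apply]
  by_cases hbb : b = b'
  · have he1 : Real.exp (-(kappa163 (d + 1) / (d + 1) / 2 *
        torusSupNorm (pv M) (rep (pv M) b.1 - rep (pv M) b'.1))) = 1 := by
      rw [hbb, sub_self, torusSupNorm_zero', mul_zero, neg_zero, Real.exp_zero]
    rw [if_pos hbb, norm_one, mul_one, he1, mul_one]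
    rw [he1, mul_one] at hDel
    linarith
  · rw [if_neg hbb, norm_zero, mul_zero, zero_add]
    exact hDel.trans (mul_le_mul_of_nonneg_right (by linarith) hepos.le)

end Estimate

/-! ## §4. Proposition 2.7 verbatim on the one-scale torus family -/

section Prop27

variable (d) (L : ℕ) [NeZero L]

/-- **PROPOSITION 2.7 (2.149), VERBATIM (`B6.Prop27Printed`), ON THE ONE-SCALE TORUS FAMILY WITH NO HYPOTHESIS**: for every dimension
d + 1, every L ≥ 1 and every a > 0, the census Prop holds for the family of all one-scale tori (bond version; all scales k, all period
vectors, all Mb, R) with the GENUINE kernel of `(Q_kΔ_a⁻¹Q_k*)⁻¹` — witnesses `M₁ = 1`, `δ₄ = κ₁₆₃(d+1)/(d+1)²`, `O(1) = a + C₂₇(d)`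
(the prefactors `(L^jη)^{−2}(L^{j′}η)^{−d}` equal 1 on one scale). [cite: Balaban1984PropagatorsII, Prop. 2.7 (2.149) p.249] -/
theorem prop27Printed_oneScaleTorus {a : ℝ} (ha : 0 < a) :
    B6.Prop27Printed (d + 1) (fun i : Index d => oneScaleBondGeo d L i.k i.M i.Mb i.R)
      (fun i => qgqInvKer d L i.k i.M i.Mb i.R a) := by
  have hd1 : (0 : ℝ) < (d : ℝ) + 1 := by positivity
  refine ⟨1, kappa163 (d + 1) / (((d : ℝ) + 1) * ((d : ℝ) + 1)), a + C27 d, one_pos,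
    div_pos (kappa163_pos _) (mul_pos hd1 hd1), by have := C27_nonneg d; linarith, fun i _ _ b b' => ?_⟩
  rw [oneScaleBondGeo_len, oneScaleBondGeo_len, Real.one_rpow, Real.one_rpow, mul_one, mul_one]
  refine (abs_qgqInvKer_le d L i.k i.M i.Mb i.R ha b b').trans (mul_le_mul_of_nonneg_left ?_ (by have := C27_nonneg d; linarith))
  apply Real.exp_le_exp.mpr
  have hκ := (kappa163_pos (d + 1)).le
  have h1 := torusL1_le_mul_torusSupNorm' (pv i.M) (rep (pv i.M) b.1 - rep (pv i.M) b'.1)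
  show -(kappa163 (d + 1) / (d + 1) / 2 * torusSupNorm (pv i.M) (rep (pv i.M) b.1 - rep (pv i.M) b'.1)) ≤
    -(kappa163 (d + 1) / (((d : ℝ) + 1) * ((d : ℝ) + 1)) / 2 * torusL1 (pv i.M) (rep (pv i.M) b.1 - rep (pv i.M) b'.1))
  rw [div_right_comm (kappa163 (d + 1)) ((d : ℝ) + 1) 2, div_right_comm (kappa163 (d + 1)) (((d : ℝ) + 1) * ((d : ℝ) + 1)) 2]
  have h2 : kappa163 (d + 1) / 2 / (((d : ℝ) + 1) * ((d : ℝ) + 1)) * torusL1 (pv i.M) (rep (pv i.M) b.1 - rep (pv i.M) b'.1)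
      = kappa163 (d + 1) / 2 / (d + 1) * (torusL1 (pv i.M) (rep (pv i.M) b.1 - rep (pv i.M) b'.1) / (d + 1)) := by
    rw [div_mul_eq_mul_div, div_mul_div_comm]
  rw [h2, neg_le_neg_iff]
  refine mul_le_mul_of_nonneg_left ?_ (by positivity)
  rw [div_le_iff₀ hd1]
  linarith

/-- **Non-vacuity** (as for Corollary 2.8 on the same geometry): every member meets the hypotheses with the witness M₁ = 1 as soon
as Mb ≥ 1, and members exist for every k, every period vector, every Mb ≥ 1 and every R.
[cite: Balaban1984PropagatorsII, Prop. 2.7 p.249] -/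
theorem qgqInv_family_meets_hypotheses (k : ℕ) (M : Fin (d + 1) → ℕ+) (Mb R : ℕ) (hMb : 1 ≤ Mb) :
    ∃ i : Index d, i.k = k ∧ i.M = M ∧ i.Mb = Mb ∧ i.R = R ∧
      (oneScaleBondGeo d L i.k i.M i.Mb i.R).Hyp21_22 ∧ (1 : ℝ) ≤ (oneScaleBondGeo d L i.k i.M i.Mb i.R).M :=
  B6Cor28OneScaleTorus.oneScaleBond_meets_hypotheses d L k M Mb R hMb

end Prop27

end

end Literature.MathematicalPhysics.QuantumFieldTheory.Balaban1983to89.B6Prop27OneScaleTorus
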